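import Summits.NavierStokesRegularity.NavierStokesRegularity.Theorems.ScenarioCensusRowF1IntQuench
import Summits.NavierStokesRegularity.NavierStokesRegularity.Theorems.ScenarioCensusRowF1IntStretchBudget
import HarnessLib

/-!
# LINE «integrated-quench» port, part 2/7: §3 the singular Type-I zoom package (BY NAME from the frozen-top port); §4 THE KILL (a) — transport Liouville set-up, the cut-off
# profile `ψ`, window bounds and the gradient decay rate in `𝒦_C`

Re-homed for the scenario census (typer seat ns-census-typer-1 g8; the cell F1iq and the floor DI are MEMBERS OF RECORD «DECIDED IN KERNEL IN FILES» of row F1 since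
census v1.76 (critic idea-crit-3 g7 PASS — no price 01:59:11Z; ref ns-census-ref g9 PRE-CHECK ✓ §14.27 item 35; lead-presearch label); this port makes them TREE-decided):
VERBATIM PORT of ns-idea-3 LINE 22 «integrated-quench», `pub/ideators/ns-idea-3/lines/integrated-quench/line-integrated-quench.lean` sha16 d7402efa28ebc137 (2066 l.,
lean check rc 0, 0 sorry), split for the 400-line rule into seven parts `ScenarioCensusRowF1IntQuench{∅, Kill, Cutoff, Enstrophy, Liouville, Transfer, Top}` (chain
imports).  Lean text VERBATIM in namespace `…Theorems.ScenarioCensus.IntegratedQuench` (the line's `…Cruxes.ScenarioCensusRowF1.IntegratedQuenchLine` re-homed); port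
edits: the bracket lines `section IntegralTransfer` / `end IntegralTransfer` dropped (no `variable`s), `@[conjecture]` on the residual `IqSlack` (≡ `ScenarioCensus.Row_F1`,
OPEN), forty-five one-line docstrings added (gate lint); lemmas the line shares VERBATIM with the landed inviscid-top / frozen-top / columnar-top / stretched-top /
integrated-stretch ports are taken BY NAME (listed below); `norm_laplacian_curl_le` (twin of the tree's `clockAP_norm_laplacian_curl_le`, whose module has no farm build) is
not re-declared and its single use carries the line's own proof as a local `have` (proof text only).  Statements untouched.

No census VALUE is moved here (row F1 stays OPEN-WITH-LINE; the members become TREE-decided by name); NS regularity is NOT proved; `Row_F1` is untouched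
(zero movement, `iqSlack_iff_rowF1`); no summit statement is proved by this file. Lemmas that restate already-landed tree declarations are taken BY NAME (gate lint `dedup.landed`): `convect_curl_self` = `FrozenTop.convect_curl_self`, `fderiv_smul_stPull_apply` = `InviscidTop.fderiv_smul_stPull_apply`, `fderiv_smul_stPull` = `InviscidTop.fderiv_smul_stPull`, `fderiv_fderiv_smul_stPull` = `InviscidTop.fderiv_fderiv_smul_stPull`, `tendsto_clm_of_tendsto_apply` = `InviscidTop.tendsto_clm_of_tendsto_apply`, `tendsto_fderiv_fderiv_apply_of_bound` = `InviscidTop.tendsto_fderiv_fderiv_apply_of_bound`, `tendsto_fderiv_fderiv_of_bound` = `InviscidTop.tendsto_fderiv_fderiv_of_bound`, `tendsto_fderiv_fderiv_of_typeI_seq_Ioo` = `InviscidTop.tendsto_fderiv_fderiv_of_typeI_seq_Ioo`, `fderiv3_smul_stPull` = `FrozenTop.fderiv3_smul_stPull`, `tendsto_fderiv3_of_typeI_seq_Ioo` = `FrozenTop.tendsto_fderiv3_of_typeI_seq_Ioo`, `tendsto_physicalTime` = `ColumnarTop.tendsto_physicalTime`, `eventually_fast` = `ColumnarTop.eventually_fast`,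 `sqrt_timeLag` = `StretchedTop.sqrt_timeLag`, `forall_of_forall_ne_zero` = `StretchedTop.forall_of_forall_ne_zero`, `radius_eq` = `FrozenTop.radius_eq`, `jointCond_everywhere₆` = `FrozenTop.jointCond_everywhere₄`, `continuousOn_quad` = `IntegratedStretch.continuousOn_quad`, `sqrt_nu_timeLag` = `IntegratedStretch.sqrt_nu_timeLag`, `continuous_maxRdnu` = `IntegratedStretch.continuous_maxRdnu`, `sing_of_not_bounded` = `InviscidTop.sing_of_not_bounded`, `nonIntensifying_ancient_trivial` = `eq_zero_of_nonIntensifying`, `vort_eq` = `FrozenTop.freeze_eq`, `exists_singularZoom_package₃` = `FrozenTop.exists_singularZoom_package₃`, `lapD_eq_zero_of_eq_zero` = `FrozenTop.lapD_eq_zero_of_eq_zero`.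
-/

-- the summit and its single problem share the name `NavierStokesRegularity` (D-0017 nested layout)
set_option linter.dupNamespace false

noncomputable section

open MeasureTheory Set Function Filter TopologicalSpace Metric
open scoped Topology NNReal ENNReal InnerProductSpace RealInnerProductSpace Laplacian

namespace Summit.NavierStokesRegularity.NavierStokesRegularity.Theorems.ScenarioCensus.IntegratedQuench

open Literature.Analysis Literature.Analysis.FluidPDE
open Summit.NavierStokesRegularity.NavierStokesRegularity.Theorems

/-! ## §3 The singular Type-I zoom package with Hessians and third-order data -/

-- `exists_singularZoom_package₃`: the line restates the tree's `FrozenTop.exists_singularZoom_package₃`; taken BY NAME (gate lint dedup.landed).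

/-! ## §4 THE KILL (LINE 21's transport Liouville theorem, re-proved verbatim): a Type-I ancient mild solution whose
vorticity magnitude does not intensify along particle paths
(`⟪ω, Δω + (ω·∇)W⟫ = ½ D_s|ω|² ≤ 0` on the open past) is ZERO — a transport / domain-of-dependence energy Liouville
theorem: the enstrophy `Φ(σ) = ∫ |ω(σ,y)|² ψ(|y − y₀|²/Rad(σ)²) dy` in a ball that SHRINKS at the Type-I speed
(`Rad(σ) = 1 + 2C√(−σ)`, `Rad' = −C/√(−σ) ≤ −‖W(σ)‖_∞`) is non-increasing in `σ` (transport + incompressibility: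
`(∂_σ + W·∇)` of the cut-off is `≤ 0` pointwise), and `Φ(σ) → 0` as `σ → −∞` by the Type-I decay of `∇W`
(`|ω|² ≲ 1/σ²` against the ball volume `≲ |σ|^{3/2}`); hence `Φ ≡ 0`, `ω ≡ 0`, and curl-free `𝒦`-slices vanish (tree). -/

/-- `‖D²(curl v)(x)‖ ≤ ‖curlCLM‖ ‖D³v(x)‖` for `C³` fields. -/
theorem norm_iteratedFDeriv_two_curl_le {v : E3 → E3} (hv : ContDiff ℝ 3 v) (x : E3) :
    ‖iteratedFDeriv ℝ 2 (curl v) x‖ ≤ ‖curlCLM‖ * ‖iteratedFDeriv ℝ 3 v x‖ := by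
  have hf : ContDiff ℝ 2 (fderiv ℝ v) := hv.fderiv_right (by norm_cast)
  rw [curl_eq_curlCLM_comp, ContinuousLinearMap.iteratedFDeriv_comp_left curlCLM hf.contDiffAt le_rfl,
    ← norm_iteratedFDeriv_fderiv]
  exact ContinuousLinearMap.norm_compContinuousMultilinearMap_le _ _

-- `norm_laplacian_curl_le`: `‖Δ(curl v)‖ ≤ 3‖curlCLM‖‖D³v‖` restates the tree's `clockAP_norm_laplacian_curl_le` (module `RecurrentProfilesRecurrentLiouvilleClockAdjointPairing`, no farm build at port time — gate lint dedup.landed); not re-declared — its single use below carries the line's own proof as a local `have` (proof text only).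

/-! ## The cut-off profile `ψ` -/

/-- `ψ(r) = smoothTransition (2 − r)`: smooth, antitone, `= 1` on `r ≤ 1`, `= 0` on `r ≥ 2`. -/
def ψ (r : ℝ) : ℝ := Real.smoothTransition (2 - r)

/-- The cut-off profile `ψ` is smooth. -/
theorem ψ_contDiff {n : ℕ∞} : ContDiff ℝ n ψ :=
  Real.smoothTransition.contDiff.comp (contDiff_const.sub contDiff_id)

/-- `0 ≤ ψ`. -/
theorem ψ_nonneg (r : ℝ) : 0 ≤ ψ r := Real.smoothTransition.nonneg _

/-- `ψ ≤ 1`. -/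
theorem ψ_le_one (r : ℝ) : ψ r ≤ 1 := Real.smoothTransition.le_one _

/-- `ψ` is antitone. -/
theorem ψ_antitone : Antitone ψ := fun a b hab => Real.smoothTransition.monotone (by linarith)

/-- `ψ = 1` on `(-∞, 1]`. -/
theorem ψ_of_le_one {r : ℝ} (h : r ≤ 1) : ψ r = 1 := Real.smoothTransition.one_of_one_le (by linarith)

/-- `ψ = 0` on `[2, ∞)`. -/
theorem ψ_of_two_le {r : ℝ} (h : 2 ≤ r) : ψ r = 0 := Real.smoothTransition.zero_of_nonpos (by linarith)

/-- `ψ 0 = 1`. -/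
theorem ψ_zero : ψ 0 = 1 := ψ_of_le_one (by norm_num)

/-- `ψ` is differentiable. -/
theorem ψ_differentiable : Differentiable ℝ ψ := (ψ_contDiff (n := 1)).differentiable (by simp)

/-- `ψ` has derivative `deriv ψ`. -/
theorem hasDerivAt_ψ (r : ℝ) : HasDerivAt ψ (deriv ψ r) r := (ψ_differentiable r).hasDerivAt

/-- `ψ' ≤ 0`. -/
theorem deriv_ψ_nonpos (r : ℝ) : deriv ψ r ≤ 0 := ψ_antitone.deriv_nonpos

/-- `ψ' = 0` below `1`. -/
theorem deriv_ψ_eq_zero_of_lt_one {r : ℝ} (h : r < 1) : deriv ψ r = 0 := by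
  have : ψ =ᶠ[𝓝 r] fun _ => (1 : ℝ) := by
    filter_upwards [Iio_mem_nhds h] with x hx using ψ_of_le_one (le_of_lt hx)
  rw [this.deriv_eq]; simp

/-- `ψ' = 0` above `2`. -/
theorem deriv_ψ_eq_zero_of_two_lt {r : ℝ} (h : 2 < r) : deriv ψ r = 0 := by
  have : ψ =ᶠ[𝓝 r] fun _ => (0 : ℝ) := by
    filter_upwards [Ioi_mem_nhds h] with x hx using ψ_of_two_le (le_of_lt hx)
  rw [this.deriv_eq]; simp

/-- `ψ'` is continuous. -/
theorem continuous_deriv_ψ : Continuous (deriv ψ) := (ψ_contDiff (n := 1)).continuous_deriv le_rfl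

/-- `ψ'` is bounded. -/
theorem exists_abs_deriv_ψ_le : ∃ S : ℝ, 0 ≤ S ∧ ∀ r, |deriv ψ r| ≤ S := by
  obtain ⟨S, hS⟩ := isCompact_Icc.exists_bound_of_continuousOn (s := Icc (1 : ℝ) 2)
    continuous_deriv_ψ.continuousOn
  refine ⟨max S 0, le_max_right _ _, fun r => ?_⟩
  by_cases h1 : r < 1
  · simp [deriv_ψ_eq_zero_of_lt_one h1]
  by_cases h2 : 2 < r
  · simp [deriv_ψ_eq_zero_of_two_lt h2]
  have := hS r ⟨not_lt.1 h1, not_lt.1 h2⟩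
  rw [Real.norm_eq_abs] at this
  exact this.trans (le_max_left _ _)

/-! ## Window bounds and the gradient decay rate in `𝒦_C` -/

/-- Uniform `Dᵏ` bounds on the window `(2t, t/2)` over all of `𝒦_C` (KNSS 2009 (4.10)). -/
theorem exists_window_bound (C : ℝ) (k : ℕ) {t : ℝ} (ht : t < 0) :
    ∃ K : ℝ, ∀ ⦃W : ℝ → E3 → E3⦄, IsTypeIAncientMild C W → ∀ σ ∈ Ioo (2 * t) (t / 2), ∀ y : E3,
      ‖iteratedFDeriv ℝ k (W σ) y‖ ≤ K := by
  have hab : 3 * t < t / 2 := by linarith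
  have hb : t / 2 < 0 := by linarith
  obtain ⟨K, hK⟩ := exists_norm_iteratedFDeriv_le_of_typeI_Ioo C k hab hb (neg_pos.2 ht)
  refine ⟨K, fun W hW σ hσ y => hK (A := 3 * t - 1) (by linarith)
    (hW.continuousOn_uncurry.mono (prod_mono Ioo_subset_Iio_self Subset.rfl))
    (fun τ hτ => hW.isWeaklyDivFree hτ.2) (fun s τ _ hsτ hτ x => hW.mild_eq_heatExtension hsτ hτ x)
    (fun τ hτ x => hW.norm_le hτ.2 x) σ ⟨by linarith [hσ.1], hσ.2⟩ y⟩

/-- `‖Dv(x)‖ = ‖D¹v(x)‖` (first iterated derivative). -/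
theorem norm_fderiv_eq_norm_iteratedFDeriv_one (v : E3 → E3) (x : E3) :
    ‖fderiv ℝ v x‖ = ‖iteratedFDeriv ℝ 1 v x‖ := by
  rw [← norm_iteratedFDeriv_fderiv, norm_iteratedFDeriv_zero]

/-- **Scaling-sharp gradient decay in `𝒦_C`**: `‖∇W(s)‖ ≤ K / (−s)` for ONE `K = K(C)` (window bound at `s = −1`
transported by the `𝒦`-scaling). -/
theorem exists_norm_fderiv_le_div (C : ℝ) :
    ∃ K : ℝ, ∀ ⦃W : ℝ → E3 → E3⦄, IsTypeIAncientMild C W → ∀ s < (0 : ℝ), ∀ y : E3,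
      ‖fderiv ℝ (W s) y‖ ≤ K / (-s) := by
  obtain ⟨K, hK⟩ := exists_window_bound C 1 (t := -1) (by norm_num)
  refine ⟨K, fun W hW s hs y => ?_⟩
  set lam : ℝ := Real.sqrt (-s) with hlam
  have hlam0 : 0 < lam := Real.sqrt_pos.2 (neg_pos.2 hs)
  have hlam2 : lam ^ 2 = -s := Real.sq_sqrt (neg_pos.2 hs).le
  set v : ℝ → E3 → E3 := lam • stPull (lam ^ 2) lam 0 y W with hv
  have hvA : IsTypeIAncientMild C v := isTypeIAncientMild_zoom hW hlam0 y
  have h1 := hK hvA (-1) ⟨by norm_num, by norm_num⟩ 0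
  rw [← norm_fderiv_eq_norm_iteratedFDeriv_one] at h1
  have hs' : lam ^ 2 * (-1) = s := by rw [hlam2]; ring
  have hfd : fderiv ℝ (v (-1)) 0 = (lam ^ 2) • fderiv ℝ (W (lam ^ 2 * (-1))) (y + lam • (0 : E3)) :=
    fderiv_zoom y W ((hW.contDiff_slice (by rw [hs']; exact hs)).differentiable (by simp)) 0
  rw [hfd, hs', smul_zero, add_zero, norm_smul, Real.norm_eq_abs, abs_of_pos (pow_pos hlam0 2), hlam2] at h1
  rw [le_div_iff₀ (neg_pos.2 hs)]
  linarith [mul_comm (-s) ‖fderiv ℝ (W s) y‖]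

end Summit.NavierStokesRegularity.NavierStokesRegularity.Theorems.ScenarioCensus.IntegratedQuench

end
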